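import Summits.AtomisticToContinuum.Crystallization.Theses.ReggeStarCoercivity
import Summits.AtomisticToContinuum.Crystallization.Theses.PalmUnimodularRigidity
import Summits.AtomisticToContinuum.Crystallization.Theorems.DefectFreeCrystallizes.Negative.PredicateAPI
import Summits.AtomisticToContinuum.Crystallization.Theorems.ReggeStarCoercivityDefectFreeCrystallizesPalmDefs
import Summits.AtomisticToContinuum.Crystallization.Theorems.ReggeStarCoercivityDefectFreeCrystallizesGoodLaw
import Summits.AtomisticToContinuum.Crystallization.Theorems.ReggeStarCoercivityDefectFreeCrystallizesFunnelChart
import Summits.AtomisticToContinuum.Crystallization.Theorems.ReggeStarCoercivityDefectFreeCrystallizesChargeFromFunnelLaw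
import Summits.AtomisticToContinuum.Crystallization.Theorems.ReggeStarCoercivityDefectFreeCrystallizesRouteBetaFloor
import Summits.AtomisticToContinuum.Crystallization.Theorems.ReggeStarCoercivityDefectFreeCrystallizesDefectVersion
import Summits.AtomisticToContinuum.Crystallization.Theorems.ReggeStarCoercivityDefectFreeCrystallizesAnnulusCount
import Summits.AtomisticToContinuum.Crystallization.Theorems.PalmUnimodularRigidityChargedPatternCrystallizes
import Summits.AtomisticToContinuum.Crystallization.Theorems.PalmUnimodularRigidityLayeredLawsSelectHcpDefs
import Summits.AtomisticToContinuum.Crystallization.Theorems.PalmUnimodularRigidityLayeredLawsSelectHcpRelaxedReference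
import Summits.AtomisticToContinuum.Crystallization.Theorems.PalmUnimodularRigidityCruxesToPalmRigidity
import Summits.AtomisticToContinuum.Crystallization.Theorems.ExcessDecayLiouvilleCoarseGrainsHcpEnergySeries
import Literature.Probability.Process.PointStationaryLaw
import Literature.MathematicalPhysics.StatisticalMechanics.BarlowStacking
import Literature.MathematicalPhysics.StatisticalMechanics.LennardJonesClusters
import Literature.Geometry.DiscreteGeometry.KissingPatterns

/-!
# Line `exact-star-shortcut` for crux `ReggeStarCoercivity.DefectFreeCrystallizes`
# (item stmt-AtomisticToContinuum-13603) — CHECKED SKELETON, crux-strategist gen 2 (2026-08-17)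

Crux (by name, concluded by `DefectFreeCrystallizes_of` below, from the three stubs through `crux_unfolded_of_stubs`):
`DefectFreeCrystallizes = (∀ ground-state sequences, defects/N → 0) → IsCrystallizing lennardJones 3`
(`PredicateAPI.defectFreeCrystallizes_iff` is `Iff.rfl`).

THE OBSERVATION.  The live line `palm-good-law` (lead c8, skeleton v28) is closed modulo TWO registered stubs: its analytic CORE
`stub_funnelDefectFloor` (law-level robust funnel floor `hcpE a₀ h₀ + κ·E_P[Dm] ≤ E_P[h]`, XL) and crux 9226 `LayeredLawsSelectHcp`
BY NAME (XL, two open cores of its own: `stub_selectionFloor`, `stub_finiteCertificate`).  But the CORE, as registered, is written with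
EXACT reference stars (the relaxed hcp star `refStar a₀ h₀` and the regular cuboctahedron `a₀ • fccKissingPattern`), so for the good
limit law `P` of the crux (minimising: `E_P[h] ≤ e* ≤ hcpE a₀ h₀`) it gives `E_P[Dm] = 0`, i.e. ALMOST SURELY `D = 0`: the root star is
EXACTLY a rotated reference star and the annulus `(11/10, 5/4]` is empty; by the landed Aldous–Lyons lemma this holds at EVERY point.
The palm-good-law glue throws this exactness away (CORE ⇒ priced floor ⇒ `1 %` shells ⇒ `RouteBeta` ⇒ 9226 re-derives exactness on
the `1 %` tube with its own certificate).  Keeping it, what remains after the CORE is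
* E1 `stub_exactStarRigidity` — a TOLERANCE-ZERO rigidity lemma (pure geometry, no potential, no measure; M/L): an everywhere-`SetGood`
  Barlow-charted set ALL of whose re-rooted stars are exact rotated copies of `refStar a₀ h₀` or of `a₀ • fccKissingPattern` (annuli
  empty) is a rotated EXACT Barlow stacking `A '' barlowStacking a₀ h s` with `h = h₀` or `h = a₀√(2/3)` — the hcp-word special case
  is LANDED as 9226's `stub_localCongruence` (p102411); mixed words force `√(a₀²/3 + h₀²) = a₀` (the fcc star's bottom triangle sits at
  the cuboctahedron distance `a₀`, the hcp star's polar triangle at `√(a₀²/3+h₀²)`), in which case `h₀ = a₀√(2/3)` and the statement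
  still holds with `h = h₀`;
* E2 `stub_exactSelectionLaw` — SELECTION AT EXACT GEOMETRY, law level (M): a point-stationary hard-core law a.s. carried by such
  exact stackings with `E_P[h] ≤ hcpE a₀ h₀` is a.s. a rotated `hcpStacking a₀ h₀`.  Its energetic content is LANDED: the
  Lennard-Jones site-energy column `hcpE a h + ½(J₃ − J₂)(c(m+1) + c(m−1)) ≤ barlowSiteEnergy lennardJones a h s m`, `J₃ − J₂ > 0`
  (`SiteColumnLJ.stub_siteColumnLJ`, p141765) and the global uniqueness of the `hcpE` minimiser (`tube_hcpE_unique_minimiser`); the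
  rest is bookkeeping (root energy of `count|A(barlowStacking)` = `barlowSiteEnergy … 0`; a.s. equality from `E_P[h] ≤ hcpE`;
  every point a.s. by `ae_forall_map_sub_of_ae`; a Hägg word with no cubic layer is `± alternatingHagg`).
So THIS LINE CLOSES THE CRUX MODULO {CORE, E1, E2}: crux 9226 LEAVES THE CONE OF 13603 (and, read the other way, CORE + E1 + E2 +
the packing lemma "Layered(1 %) ⇒ SetGood + chart (0, 6/5)" would close 9226 itself — recorded for 9226's lead, not used here).

  X1  `stub_funnelDefectFloor`   = the lead's registered CORE, VERBATIM (same name, same signature: ONE proof closes both lines).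
  X2  `stub_exactStarRigidity`   E1, tolerance-zero geometry (M/L).
  X3  `stub_exactSelectionLaw`   E2, exact-geometry selection at law level over the landed column (M).

`crux_unfolded_of_stubs : X1 → X2 → X3 → crux (unfolded)` and `DefectFreeCrystallizes_of : crux` (by name) are kernel-checked below: the glue `ae_exactRoot_of_core` (CORE ⇒ a.s. exact root
star; the measurable `Dm` is assembled from the LANDED V `DefectVersion.stub_defectVersion` ×2 and A `AnnulusCount.stub_annulusCount`
exactly as in lead c8's v27 glue, then `lintegral_eq_zero_iff'` instead of Markov), `funnelLawRigidity_of_stubs` (relaxed reference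
`stub_relaxedReference`, `e* ≤ hcpE` `RouteBetaFloor.iInf_le_hcpE`, a.s. force balance / zero mean stress of minimising laws
`RouteBetaFloor.ae_forceBalance_of_minimising` / `zeroMeanStress_of_minimising`, the funnel chart `FunnelChart.stub_funnelChart` (R1,
landed), every point a.s. `ae_forall_map_sub_of_ae`, then X2, X3), and the landed back end P1 `PalmGoodLaw.stub_goodLaw` + R3
`ChargeFromFunnelLaw.stub_chargeFromFunnelLaw` + item 2916 `chargedPatternCrystallizes_proof` + `LennardJonesMinimalDistance_holds`.
Sorries live ONLY in the three `stub_*`.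

Disproof used: §8 `not_defectFreeCrystallizesWithoutGroundStates` (any proof must consume exact minimality for strain AND stacking) —
honoured: minimality enters X1 (strain/registry exactification at level `hcpE`) and X3 (stacking selection at exact geometry, through
`E_P[h] ≤ hcpE`); no stub is an instance of a landed `Negative/` lemma (TypeGap, IcosahedralShellsCharged, StrainBlindness concern the
`1/20` predicate, which this line only consumes through the landed chart).
-/

noncomputable section

open scoped BigOperators ENNReal
open Filter Topology MeasureTheory

namespace Summit.AtomisticToContinuum.Crystallization.Cruxes.DefectFreeCrystallizes.ExactStarShortcut

open Summit.AtomisticToContinuum.Crystallization.Theses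
open Summit.AtomisticToContinuum.Crystallization.Theorems.DefectFreeCrystallizes.Negative.PredicateAPI
open Summit.AtomisticToContinuum.Crystallization.Theorems.PalmGoodLaw (SetGood)
open Summit.AtomisticToContinuum.Crystallization.Theorems.PalmUnimodularRigidity
  (ae_forall_map_sub_of_ae count_restrict_floorNorm_preimage_lt_top)
open Summit.AtomisticToContinuum.Crystallization.Theorems.PalmUnimodularRigidity.LayeredLawsSelectHcp
  (hcpE hcpQ hcpSite hcpStarIdx rootStar starDefect starDefect_nonneg stub_relaxedReference)
open Literature.MathematicalPhysics.StatisticalMechanics Literature.Geometry.DiscreteGeometry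
open Literature.Probability.Process

local notation "E3" => EuclideanSpace ℝ (Fin 3)

/-! ## Registered stubs (the only sorries of the file) -/

/-- **X1 = the CORE `stub_funnelDefectFloor` of line `palm-good-law` VERBATIM (lead c8 v27; XL; shared BY NAME AND SIGNATURE — one
proof closes the stub of both lines).**  ROBUST FUNNEL FLOOR: for the relaxed reference `(a₀, h₀)` and every hard core `δ > 0` there is
`κ > 0` such that for every measurable `Dm` agreeing on rooted `δ`-hard-core configurations with
`D(μ) = min (starDefect a₀ h₀ μ) (⨅_A Σ_{p ∈ fccKissingPattern} infDist(A(a₀ p), rootStar μ)²) + #{atoms y : 11/10 < ‖y‖ ≤ 5/4}`, and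
every point-stationary rooted `δ`-hard-core law `P` a.s. carried by everywhere-`SetGood` Barlow-charted force-balanced configurations with
zero mean virial stress: `hcpE a₀ h₀ + κ · E_P[Dm] ≤ E_P[h]`.  Why it might fail / numbers / architecture: the lead's docstring in
`Lines/palm_good_law.lean` and `Cruxes/DefectFreeCrystallizes/NOTES.md` (c8). [folklore] -/
theorem stub_funnelDefectFloor :
    ∀ a₀ h₀ : ℝ, 189 / 200 ≤ a₀ → a₀ ≤ 199 / 200 → 77 / 100 ≤ h₀ → h₀ ≤ 163 / 200 →
      (∀ a h : ℝ, 0 < a → 0 < h →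
        Summit.AtomisticToContinuum.Crystallization.Theorems.PalmUnimodularRigidity.LayeredLawsSelectHcp.hcpE a₀ h₀ ≤
          Summit.AtomisticToContinuum.Crystallization.Theorems.PalmUnimodularRigidity.LayeredLawsSelectHcp.hcpE a h) →
      ∀ δ : ℝ, 0 < δ → ∃ κ : ℝ, 0 < κ ∧
        ∀ Dm : Measure (EuclideanSpace ℝ (Fin 3)) → ℝ≥0∞, Measurable Dm →
          (∀ μ : Measure (EuclideanSpace ℝ (Fin 3)), IsRootedHardCore δ μ →
            Dm μ = ENNReal.ofReal
              (min (Summit.AtomisticToContinuum.Crystallization.Theorems.PalmUnimodularRigidity.LayeredLawsSelectHcp.starDefect a₀ h₀ μ)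
                  (⨅ A : EuclideanSpace ℝ (Fin 3) ≃ₗᵢ[ℝ] EuclideanSpace ℝ (Fin 3),
                    ∑ p ∈ fccKissingPattern, Metric.infDist (A (a₀ • p)) (Summit.AtomisticToContinuum.Crystallization.Theorems.PalmUnimodularRigidity.LayeredLawsSelectHcp.rootStar μ) ^ 2) +
                (μ {y : EuclideanSpace ℝ (Fin 3) | 11 / 10 < ‖y‖ ∧ ‖y‖ ≤ 5 / 4}).toReal)) →
          ∀ P : Measure (Measure (EuclideanSpace ℝ (Fin 3))), IsProbabilityMeasure P →
            (∀ᵐ μ ∂P, IsRootedHardCore δ μ) → IsPointStationaryLaw P →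
            (∀ᵐ μ ∂P, ∃ S : Set (EuclideanSpace ℝ (Fin 3)),
              μ = (Measure.count : Measure (EuclideanSpace ℝ (Fin 3))).restrict S ∧
              (∀ y ∈ S, SetGood S y) ∧
              ∃ s : ℤ → ℤ, IsHaggSeq s ∧
                ∃ Φ : EuclideanSpace ℝ (Fin 3) → EuclideanSpace ℝ (Fin 3),
                  Set.BijOn Φ (barlowStacking 1 (Real.sqrt (2 / 3)) s) S ∧
                  ∀ p ∈ barlowStacking 1 (Real.sqrt (2 / 3)) s, ∀ q ∈ barlowStacking 1 (Real.sqrt (2 / 3)) s,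
                    (dist p q = 1 ↔ (0 < dist (Φ p) (Φ q) ∧ dist (Φ p) (Φ q) < 6 / 5))) →
            (∀ᵐ μ ∂P, ∃ S : Set (EuclideanSpace ℝ (Fin 3)),
              μ = (Measure.count : Measure (EuclideanSpace ℝ (Fin 3))).restrict S ∧
              ∀ p ∈ S, HasSum (fun q : {q : EuclideanSpace ℝ (Fin 3) // q ∈ S ∧ q ≠ p} =>
                (deriv lennardJones (dist p q.1) / dist p q.1) • (p - q.1)) 0) →
            (∀ M : EuclideanSpace ℝ (Fin 3) →L[ℝ] EuclideanSpace ℝ (Fin 3),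
              ∫ μ, (∫ y, deriv lennardJones ‖y‖ / ‖y‖ * inner ℝ y (M y) ∂μ) ∂P = 0) →
            Summit.AtomisticToContinuum.Crystallization.Theorems.PalmUnimodularRigidity.LayeredLawsSelectHcp.hcpE a₀ h₀ +
                κ * (∫⁻ μ, Dm μ ∂P).toReal ≤
              ∫ μ, (∫ y, lennardJones ‖y‖ ∂μ) / 2 ∂P := by
  sorry

/-- **X2 `stub_exactStarRigidity` (E1, size M/L: tolerance-ZERO geometry — no potential, no measure).**  EXACT STARS EVERYWHERE ⇒ AN
EXACT STACKING.  Let `(a₀, h₀)` lie in the relaxed-reference box, `S ⊆ ℝ³` contain `0`, have all its points `SetGood`, and be globally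
bond-isomorphic to an ideal Barlow stacking (the funnel chart: `Φ : barlowStacking 1 √(2/3) s → S` bijective, ideal contacts `↔`
pairs at distance in `(0, 6/5)`).  Suppose that at EVERY `x ∈ S` the re-rooted configuration `S − x` has an EXACT star — congruence
defect `0` against the relaxed hcp star `refStar a₀ h₀` (twelve strut vectors: six in-layer of length `a₀`, three up and three down,
eclipsed, of length `√(a₀²/3 + h₀²)`) OR against the regular cuboctahedron `a₀ • fccKissingPattern` — and no atom with
`11/10 < ‖y − x‖ ≤ 5/4`.  Then `S = A '' barlowStacking a₀ h s'` for ONE linear isometry `A`, a Hägg word `s'` and a layer spacing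
`h ∈ {h₀, a₀√(2/3)}`.  Proof sketch: the infimum over the compact `O(3)` is attained and the star has exactly twelve points
(`TwelveNeighbours.stub_twelveNeighbours`, norms `≤ 0.9971 < 11/10`), so `star(x) = A_x(Ref_{t(x)})` exactly; metric type = chart type
(cuboctahedral vs anticuboctahedral link graph); reconstruct layer by layer: in-layer propagation is rigid (adjacent exact stars share
the bond's ends and four non-coplanar common neighbours; stabiliser analysis), the layer above a reconstructed layer is placed by the
stars of the layer below, and the next layer is the reflection of the known triangle in the hexagon plane (anticuboctahedron: unique
centred planar hexagon) or its point reflection (cuboctahedron: central symmetry) — so spacing and registry propagate with ONE linear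
part; the spacing seen from an h-site is `h₀`, from a c-site `a₀√(2/3)`, hence uniform `h`, and both letters can coexist only if
`√(a₀²/3 + h₀²) = a₀` (the bottom triangle of a c-site's cuboctahedron is the polar triangle of the h-site above it), i.e.
`h₀ = a₀√(2/3)`; finally re-root the stacking at the label of `0` (`hcpStacking_homogeneous`-type rebasing for Barlow words,
`BarlowStackingWindowRebase`).  The hcp-word case (`HcpCharted`, `GoodShell`) is LANDED: 9226's `stub_localCongruence` (p102411).
Why it might fail: only Lean bookkeeping (the geometry has margins: second distances `≥ 1.33 > 6/5`, star radii `< 11/10`); a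
counterexample would be an everywhere-exact-star charted set that is not a uniformly spaced stacking — excluded by the shared-spacing
argument above. [folklore] -/
theorem stub_exactStarRigidity :
    ∀ a₀ h₀ : ℝ, 189 / 200 ≤ a₀ → a₀ ≤ 199 / 200 → 77 / 100 ≤ h₀ → h₀ ≤ 163 / 200 →
      ∀ S : Set (EuclideanSpace ℝ (Fin 3)), (0 : EuclideanSpace ℝ (Fin 3)) ∈ S →
        (∀ y ∈ S, SetGood S y) →
        (∃ s : ℤ → ℤ, IsHaggSeq s ∧
          ∃ Φ : EuclideanSpace ℝ (Fin 3) → EuclideanSpace ℝ (Fin 3),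
            Set.BijOn Φ (barlowStacking 1 (Real.sqrt (2 / 3)) s) S ∧
            ∀ p ∈ barlowStacking 1 (Real.sqrt (2 / 3)) s, ∀ q ∈ barlowStacking 1 (Real.sqrt (2 / 3)) s,
              (dist p q = 1 ↔ (0 < dist (Φ p) (Φ q) ∧ dist (Φ p) (Φ q) < 6 / 5))) →
        (∀ x ∈ S,
          (Summit.AtomisticToContinuum.Crystallization.Theorems.PalmUnimodularRigidity.LayeredLawsSelectHcp.starDefect a₀ h₀
              ((Measure.count : Measure (EuclideanSpace ℝ (Fin 3))).restrict ((fun z : EuclideanSpace ℝ (Fin 3) => z - x) '' S)) = 0 ∨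
            (⨅ A : EuclideanSpace ℝ (Fin 3) ≃ₗᵢ[ℝ] EuclideanSpace ℝ (Fin 3),
              ∑ p ∈ fccKissingPattern, Metric.infDist (A (a₀ • p))
                (Summit.AtomisticToContinuum.Crystallization.Theorems.PalmUnimodularRigidity.LayeredLawsSelectHcp.rootStar
                  ((Measure.count : Measure (EuclideanSpace ℝ (Fin 3))).restrict ((fun z : EuclideanSpace ℝ (Fin 3) => z - x) '' S))) ^ 2) = 0) ∧
          (Measure.count : Measure (EuclideanSpace ℝ (Fin 3))).restrict ((fun z : EuclideanSpace ℝ (Fin 3) => z - x) '' S)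
            {y : EuclideanSpace ℝ (Fin 3) | 11 / 10 < ‖y‖ ∧ ‖y‖ ≤ 5 / 4} = 0) →
        ∃ A : EuclideanSpace ℝ (Fin 3) ≃ₗᵢ[ℝ] EuclideanSpace ℝ (Fin 3), ∃ h : ℝ, (h = h₀ ∨ h = a₀ * Real.sqrt (2 / 3)) ∧
          ∃ s' : ℤ → ℤ, IsHaggSeq s' ∧ S = A '' barlowStacking a₀ h s' := by
  sorry

/-- **X3 `stub_exactSelectionLaw` (E2, size M: law-level bookkeeping over LANDED energetics).**  SELECTION AT EXACT GEOMETRY: for the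
relaxed reference `(a₀, h₀)` (box + global `hcpE`-minimality), a point-stationary probability law on rooted `δ`-hard-core
configurations which is a.s. the counting measure of a rotated EXACT stacking `A '' barlowStacking a₀ h s` with `h ∈ {h₀, a₀√(2/3)}`
and whose mean root energy is `≤ hcpE a₀ h₀` is a.s. a rotated `hcpStacking a₀ h₀`.  Intended proof: the root of
`count|A(barlowStacking a₀ h s)` is the site `(0,0,0)` and its energy `½ Σ_{y ≠ 0} V(‖y‖)` is `barlowSiteEnergy lennardJones a₀ h s 0`
(rotation invariance + regrouping the absolutely convergent sum by layers; hcp instance landed as `rootEnergy_isometric_hcp`); both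
spacings lie in the column box by the enclosure `|a₀ − 0.97129|, |h₀ − 0.79294| ≤ 10⁻⁴` (`tube_minimiserEnclosure`); the LANDED column
`SiteColumnLJ.stub_siteColumnLJ` (p141765) gives `root energy ≥ hcpE a₀ h + ½(J₃−J₂)(c(1)+c(−1)) ≥ hcpE a₀ h ≥ hcpE a₀ h₀` with
`J₃ − J₂ > 0`; `E_P[h] ≤ hcpE a₀ h₀` forces a.s. equality (the integrand is integrable because the integral is not the junk `0 > hcpE`),
hence a.s. `hcpE a₀ h = hcpE a₀ h₀` — so `h = h₀` by `tube_hcpE_unique_minimiser` — and no cubic layer adjacent to the root; by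
`ae_forall_map_sub_of_ae` (re-rooting at the image of site `(k,i,j)` shifts the word by `k`) a.s. NO layer is cubic, so the word is
`± alternatingHagg` up to shift and `A '' barlowStacking a₀ h₀ s = A' '' hcpStacking a₀ h₀`.  Why it might fail: it cannot on the
energetics (landed, `J₃ − J₂ > 0` certified on the box); the risk is the `tsum` regrouping and measurability plumbing. [folklore] -/
theorem stub_exactSelectionLaw :
    ∀ a₀ h₀ : ℝ, 189 / 200 ≤ a₀ → a₀ ≤ 199 / 200 → 77 / 100 ≤ h₀ → h₀ ≤ 163 / 200 →
      (∀ a h : ℝ, 0 < a → 0 < h →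
        Summit.AtomisticToContinuum.Crystallization.Theorems.PalmUnimodularRigidity.LayeredLawsSelectHcp.hcpE a₀ h₀ ≤
          Summit.AtomisticToContinuum.Crystallization.Theorems.PalmUnimodularRigidity.LayeredLawsSelectHcp.hcpE a h) →
      ∀ δ : ℝ, 0 < δ → ∀ P : Measure (Measure (EuclideanSpace ℝ (Fin 3))), IsProbabilityMeasure P →
        (∀ᵐ μ ∂P, IsRootedHardCore δ μ) → IsPointStationaryLaw P →
        (∫ μ, (∫ y, lennardJones ‖y‖ ∂μ) / 2 ∂P) ≤
          Summit.AtomisticToContinuum.Crystallization.Theorems.PalmUnimodularRigidity.LayeredLawsSelectHcp.hcpE a₀ h₀ →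
        (∀ᵐ μ ∂P, ∃ A : EuclideanSpace ℝ (Fin 3) ≃ₗᵢ[ℝ] EuclideanSpace ℝ (Fin 3), ∃ h : ℝ,
          (h = h₀ ∨ h = a₀ * Real.sqrt (2 / 3)) ∧ ∃ s : ℤ → ℤ, IsHaggSeq s ∧
            μ = (Measure.count : Measure (EuclideanSpace ℝ (Fin 3))).restrict (A '' barlowStacking a₀ h s)) →
        ∀ᵐ μ ∂P, ∃ A : EuclideanSpace ℝ (Fin 3) ≃ₗᵢ[ℝ] EuclideanSpace ℝ (Fin 3),
          μ = (Measure.count : Measure (EuclideanSpace ℝ (Fin 3))).restrict (A '' hcpStacking a₀ h₀) := by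
  sorry

/-! ## Glue 1 (no sorry): the CORE forces a.s. EXACT root stars on a law at the level `hcpE a₀ h₀`

The measurable version `Dm` of the defect functional is assembled exactly as in lead c8's v27 glue `stub_funnelPricedFloor`
(`Lines/palm_good_law.lean`; V = `DefectVersion.stub_defectVersion` p146247 instantiated twice, A = `AnnulusCount.stub_annulusCount`
p146063); then `hcpE + κ·E_P[Dm] ≤ E_P[h] ≤ hcpE` gives `E_P[Dm] = 0` (it is finite), `Dm = 0` a.e. (`lintegral_eq_zero_iff'`), and on
hard-core configurations `Dm = ofReal (min(starDefect, fccDefect) + #annulus)` with both summands `≥ 0`. -/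

/-- **CORE ⇒ a.s. exact root star** (and the level is attained: `hcpE a₀ h₀ ≤ E_P[h]`). [folklore] -/
theorem ae_exactRoot_of_core
    (hCORE : ∀ a₀ h₀ : ℝ, 189 / 200 ≤ a₀ → a₀ ≤ 199 / 200 → 77 / 100 ≤ h₀ → h₀ ≤ 163 / 200 →
      (∀ a h : ℝ, 0 < a → 0 < h → hcpE a₀ h₀ ≤ hcpE a h) →
      ∀ δ : ℝ, 0 < δ → ∃ κ : ℝ, 0 < κ ∧
        ∀ Dm : Measure (EuclideanSpace ℝ (Fin 3)) → ℝ≥0∞, Measurable Dm →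
          (∀ μ : Measure (EuclideanSpace ℝ (Fin 3)), IsRootedHardCore δ μ →
            Dm μ = ENNReal.ofReal
              (min (starDefect a₀ h₀ μ)
                  (⨅ A : EuclideanSpace ℝ (Fin 3) ≃ₗᵢ[ℝ] EuclideanSpace ℝ (Fin 3),
                    ∑ p ∈ fccKissingPattern, Metric.infDist (A (a₀ • p)) (rootStar μ) ^ 2) +
                (μ {y : EuclideanSpace ℝ (Fin 3) | 11 / 10 < ‖y‖ ∧ ‖y‖ ≤ 5 / 4}).toReal)) →
          ∀ P : Measure (Measure (EuclideanSpace ℝ (Fin 3))), IsProbabilityMeasure P →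
            (∀ᵐ μ ∂P, IsRootedHardCore δ μ) → IsPointStationaryLaw P →
            (∀ᵐ μ ∂P, ∃ S : Set (EuclideanSpace ℝ (Fin 3)),
              μ = (Measure.count : Measure (EuclideanSpace ℝ (Fin 3))).restrict S ∧
              (∀ y ∈ S, SetGood S y) ∧
              ∃ s : ℤ → ℤ, IsHaggSeq s ∧
                ∃ Φ : EuclideanSpace ℝ (Fin 3) → EuclideanSpace ℝ (Fin 3),
                  Set.BijOn Φ (barlowStacking 1 (Real.sqrt (2 / 3)) s) S ∧
                  ∀ p ∈ barlowStacking 1 (Real.sqrt (2 / 3)) s, ∀ q ∈ barlowStacking 1 (Real.sqrt (2 / 3)) s,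
                    (dist p q = 1 ↔ (0 < dist (Φ p) (Φ q) ∧ dist (Φ p) (Φ q) < 6 / 5))) →
            (∀ᵐ μ ∂P, ∃ S : Set (EuclideanSpace ℝ (Fin 3)),
              μ = (Measure.count : Measure (EuclideanSpace ℝ (Fin 3))).restrict S ∧
              ∀ p ∈ S, HasSum (fun q : {q : EuclideanSpace ℝ (Fin 3) // q ∈ S ∧ q ≠ p} =>
                (deriv lennardJones (dist p q.1) / dist p q.1) • (p - q.1)) 0) →
            (∀ M : EuclideanSpace ℝ (Fin 3) →L[ℝ] EuclideanSpace ℝ (Fin 3),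
              ∫ μ, (∫ y, deriv lennardJones ‖y‖ / ‖y‖ * inner ℝ y (M y) ∂μ) ∂P = 0) →
            hcpE a₀ h₀ + κ * (∫⁻ μ, Dm μ ∂P).toReal ≤ ∫ μ, (∫ y, lennardJones ‖y‖ ∂μ) / 2 ∂P)
    {a₀ h₀ : ℝ} (ha₁ : 189 / 200 ≤ a₀) (ha₂ : a₀ ≤ 199 / 200) (hh₁ : 77 / 100 ≤ h₀) (hh₂ : h₀ ≤ 163 / 200)
    (hmin : ∀ a h : ℝ, 0 < a → 0 < h → hcpE a₀ h₀ ≤ hcpE a h)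
    {δ : ℝ} (hδ : 0 < δ) {P : Measure (Measure (EuclideanSpace ℝ (Fin 3)))} [hP : IsProbabilityMeasure P]
    (hhc : ∀ᵐ μ ∂P, IsRootedHardCore δ μ) (hstat : IsPointStationaryLaw P)
    (hchart : ∀ᵐ μ ∂P, ∃ S : Set (EuclideanSpace ℝ (Fin 3)),
      μ = (Measure.count : Measure (EuclideanSpace ℝ (Fin 3))).restrict S ∧
      (∀ y ∈ S, SetGood S y) ∧
      ∃ s : ℤ → ℤ, IsHaggSeq s ∧
        ∃ Φ : EuclideanSpace ℝ (Fin 3) → EuclideanSpace ℝ (Fin 3),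
          Set.BijOn Φ (barlowStacking 1 (Real.sqrt (2 / 3)) s) S ∧
          ∀ p ∈ barlowStacking 1 (Real.sqrt (2 / 3)) s, ∀ q ∈ barlowStacking 1 (Real.sqrt (2 / 3)) s,
            (dist p q = 1 ↔ (0 < dist (Φ p) (Φ q) ∧ dist (Φ p) (Φ q) < 6 / 5)))
    (hFB : ∀ᵐ μ ∂P, ∃ S : Set (EuclideanSpace ℝ (Fin 3)),
      μ = (Measure.count : Measure (EuclideanSpace ℝ (Fin 3))).restrict S ∧
      ∀ p ∈ S, HasSum (fun q : {q : EuclideanSpace ℝ (Fin 3) // q ∈ S ∧ q ≠ p} =>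
        (deriv lennardJones (dist p q.1) / dist p q.1) • (p - q.1)) 0)
    (hZS : ∀ M : EuclideanSpace ℝ (Fin 3) →L[ℝ] EuclideanSpace ℝ (Fin 3),
      ∫ μ, (∫ y, deriv lennardJones ‖y‖ / ‖y‖ * inner ℝ y (M y) ∂μ) ∂P = 0)
    (hlevel : (∫ μ, (∫ y, lennardJones ‖y‖ ∂μ) / 2 ∂P) ≤ hcpE a₀ h₀) :
    hcpE a₀ h₀ ≤ (∫ μ, (∫ y, lennardJones ‖y‖ ∂μ) / 2 ∂P) ∧
    ∀ᵐ μ ∂P,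
      (starDefect a₀ h₀ μ = 0 ∨
        (⨅ A : EuclideanSpace ℝ (Fin 3) ≃ₗᵢ[ℝ] EuclideanSpace ℝ (Fin 3),
          ∑ p ∈ fccKissingPattern, Metric.infDist (A (a₀ • p)) (rootStar μ) ^ 2) = 0) ∧
      μ {y : EuclideanSpace ℝ (Fin 3) | 11 / 10 < ‖y‖ ∧ ‖y‖ ≤ 5 / 4} = 0 := by
  classical
  obtain ⟨κ, hκ, hcore⟩ := hCORE a₀ h₀ ha₁ ha₂ hh₁ hh₂ hmin δ hδ
  -- measurable versions of the two star defects (V, instantiated twice) and the annulus packing bound (A)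
  set eH := (hcpStarIdx).equivFin with heH
  obtain ⟨Dh, hDh_m, hDh_le, hDh_eq⟩ :=
    Summit.AtomisticToContinuum.Crystallization.Theorems.PalmGoodLaw.DefectVersion.stub_defectVersion _
      (fun i => hcpSite a₀ h₀ ((eH.symm i : hcpStarIdx) : ℤ × ℤ × ℤ)) δ hδ
  set eF := (fccKissingPattern).equivFin with heF
  obtain ⟨Df, hDf_m, hDf_le, hDf_eq⟩ :=
    Summit.AtomisticToContinuum.Crystallization.Theorems.PalmGoodLaw.DefectVersion.stub_defectVersion _
      (fun i => a₀ • ((eF.symm i : fccKissingPattern) : E3)) δ hδ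
  obtain ⟨N, hN⟩ :=
    Summit.AtomisticToContinuum.Crystallization.Theorems.PalmGoodLaw.AnnulusCount.stub_annulusCount δ hδ
  -- the annulus event and the measurable version `Dm` of the defect functional
  set ann : Set E3 := {y : E3 | 11 / 10 < ‖y‖ ∧ ‖y‖ ≤ 5 / 4} with hann
  have hann_m : MeasurableSet ann :=
    (measurableSet_lt measurable_const measurable_norm).inter (measurableSet_le measurable_norm measurable_const)
  set Dm : Measure E3 → ℝ≥0∞ := fun μ => min (Dh μ) (Df μ) + μ ann with hDm
  have hDm_m : Measurable Dm := (hDh_m.min hDf_m).add (Measure.measurable_coe hann_m)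
  -- read-backs of the two instantiated sums
  have hsumH : ∀ (A : E3 ≃ₗᵢ[ℝ] E3) (μ : Measure E3),
      (∑ i, Metric.infDist (A (hcpSite a₀ h₀ ((eH.symm i : hcpStarIdx) : ℤ × ℤ × ℤ))) (rootStar μ) ^ 2) =
        ∑ v ∈ hcpStarIdx, Metric.infDist (A (hcpSite a₀ h₀ v)) (rootStar μ) ^ 2 := by
    intro A μ
    rw [← Finset.sum_coe_sort hcpStarIdx
      (fun v : ℤ × ℤ × ℤ => Metric.infDist (A (hcpSite a₀ h₀ v)) (rootStar μ) ^ 2)]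
    exact Fintype.sum_equiv eH.symm _ _ (fun i => rfl)
  have hsumF : ∀ (A : E3 ≃ₗᵢ[ℝ] E3) (μ : Measure E3),
      (∑ i, Metric.infDist (A (a₀ • ((eF.symm i : fccKissingPattern) : E3))) (rootStar μ) ^ 2) =
        ∑ p ∈ fccKissingPattern, Metric.infDist (A (a₀ • p)) (rootStar μ) ^ 2 := by
    intro A μ
    rw [← Finset.sum_coe_sort fccKissingPattern
      (fun p : E3 => Metric.infDist (A (a₀ • p)) (rootStar μ) ^ 2)]
    exact Fintype.sum_equiv eF.symm _ _ (fun i => rfl)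
  have hstar : ∀ μ : Measure E3, IsRootedHardCore δ μ →
      Dh μ = ENNReal.ofReal (starDefect a₀ h₀ μ) := by
    intro μ hμ
    rw [hDh_eq μ hμ]
    simp_rw [hsumH]
    rfl
  have hfcc : ∀ μ : Measure E3, IsRootedHardCore δ μ →
      Df μ = ENNReal.ofReal (⨅ A : E3 ≃ₗᵢ[ℝ] E3,
        ∑ p ∈ fccKissingPattern, Metric.infDist (A (a₀ • p)) (rootStar μ) ^ 2) := by
    intro μ hμ
    rw [hDf_eq μ hμ]
    simp_rw [hsumF]
  have hann_fin : ∀ μ : Measure E3, IsRootedHardCore δ μ → μ ann ≠ ⊤ := fun μ hμ =>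
    ne_top_of_le_ne_top (ENNReal.natCast_ne_top N) (hN μ hμ)
  have hfcc_nonneg : ∀ μ : Measure E3, 0 ≤ ⨅ A : E3 ≃ₗᵢ[ℝ] E3,
      ∑ p ∈ fccKissingPattern, Metric.infDist (A (a₀ • p)) (rootStar μ) ^ 2 :=
    fun μ => Real.iInf_nonneg fun _ => Finset.sum_nonneg fun _ _ => sq_nonneg _
  have hagree : ∀ μ : Measure E3, IsRootedHardCore δ μ →
      Dm μ = ENNReal.ofReal
        (min (starDefect a₀ h₀ μ)
            (⨅ A : E3 ≃ₗᵢ[ℝ] E3,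
              ∑ p ∈ fccKissingPattern, Metric.infDist (A (a₀ • p)) (rootStar μ) ^ 2) +
          (μ {y : E3 | 11 / 10 < ‖y‖ ∧ ‖y‖ ≤ 5 / 4}).toReal) := by
    intro μ hμ
    have hmono : Monotone ENNReal.ofReal := fun _ _ h => ENNReal.ofReal_le_ofReal h
    rw [ENNReal.ofReal_add (le_min (starDefect_nonneg a₀ h₀ μ) (hfcc_nonneg μ)) ENNReal.toReal_nonneg,
      hmono.map_min, ENNReal.ofReal_toReal (hann_fin μ hμ), hDm]
    simp only
    rw [hstar μ hμ, hfcc μ hμ]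
  -- the floor on `P`
  have hfloor := hcore Dm hDm_m hagree P hP hhc hstat hchart hFB hZS
  -- finiteness of `E_P[Dm]`
  have hbound : ∀ᵐ μ ∂P, Dm μ ≤
      ENNReal.ofReal (∑ i, (‖hcpSite a₀ h₀ ((eH.symm i : hcpStarIdx) : ℤ × ℤ × ℤ)‖ + 11 / 10) ^ 2) + N := by
    filter_upwards [hhc] with μ hμ
    exact add_le_add ((min_le_left _ _).trans (hDh_le μ)) (hN μ hμ)
  have hfin : ∫⁻ μ, Dm μ ∂P ≠ ⊤ := by
    refine ne_top_of_le_ne_top ?_ (lintegral_mono_ae hbound)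
    rw [lintegral_const, measure_univ, mul_one]
    exact ENNReal.add_ne_top.2 ⟨ENNReal.ofReal_ne_top, ENNReal.natCast_ne_top N⟩
  -- the level is attained and `E_P[Dm] = 0`
  have hnonneg : 0 ≤ κ * (∫⁻ μ, Dm μ ∂P).toReal := mul_nonneg hκ.le ENNReal.toReal_nonneg
  refine ⟨by linarith, ?_⟩
  have htr0 : (∫⁻ μ, Dm μ ∂P).toReal = 0 := by
    have h1 : κ * (∫⁻ μ, Dm μ ∂P).toReal ≤ κ * 0 := by rw [mul_zero]; linarith
    exact le_antisymm (le_of_mul_le_mul_left h1 hκ) ENNReal.toReal_nonneg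
  have hl0 : ∫⁻ μ, Dm μ ∂P = 0 := by
    rcases (ENNReal.toReal_eq_zero_iff _).1 htr0 with h | h
    · exact h
    · exact absurd h hfin
  have hae0 : ∀ᵐ μ ∂P, Dm μ = 0 := (lintegral_eq_zero_iff' hDm_m.aemeasurable).1 hl0
  filter_upwards [hae0, hhc] with μ h0 hμ
  have hD := hagree μ hμ
  rw [h0] at hD
  have hle := ENNReal.ofReal_eq_zero.1 hD.symm
  have hmin0 : 0 ≤ min (starDefect a₀ h₀ μ)
      (⨅ A : E3 ≃ₗᵢ[ℝ] E3, ∑ p ∈ fccKissingPattern, Metric.infDist (A (a₀ • p)) (rootStar μ) ^ 2) :=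
    le_min (starDefect_nonneg a₀ h₀ μ) (hfcc_nonneg μ)
  have htR : 0 ≤ (μ {y : E3 | 11 / 10 < ‖y‖ ∧ ‖y‖ ≤ 5 / 4}).toReal := ENNReal.toReal_nonneg
  have hm : min (starDefect a₀ h₀ μ)
      (⨅ A : E3 ≃ₗᵢ[ℝ] E3, ∑ p ∈ fccKissingPattern, Metric.infDist (A (a₀ • p)) (rootStar μ) ^ 2) = 0 := by
    linarith
  have ht : (μ {y : E3 | 11 / 10 < ‖y‖ ∧ ‖y‖ ≤ 5 / 4}).toReal = 0 := by linarith
  refine ⟨?_, ?_⟩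
  · rcases min_eq_iff.1 hm with h | h
    · exact Or.inl h.1
    · exact Or.inr h.1
  · rcases (ENNReal.toReal_eq_zero_iff _).1 ht with h | h
    · exact h
    · exact absurd h (hann_fin μ hμ)

/-! ## Glue 2 (no sorry): FUNNEL LAW RIGIDITY from X1 + X2 + X3

FunnelLawRigidity (the hypothesis of the LANDED R3 `ChargeFromFunnelLaw.stub_chargeFromFunnelLaw`, verbatim): a minimising
(`E_P[h] ≤ e*`) point-stationary `δ`-hard-core law a.s. carried by everywhere-`SetGood` configurations is a.s. an exact rotated relaxed
hcp crystal `count|A(hcpStacking a h)`, `(a,h) ∈ [1/2,2]²`, `e(hcp a h) = e*`. -/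

/-- **X1 → X2 → X3 → funnel law rigidity** (sorry-free glue). [folklore] -/
theorem funnelLawRigidity_of_stubs
    (hCORE : ∀ a₀ h₀ : ℝ, 189 / 200 ≤ a₀ → a₀ ≤ 199 / 200 → 77 / 100 ≤ h₀ → h₀ ≤ 163 / 200 →
      (∀ a h : ℝ, 0 < a → 0 < h → hcpE a₀ h₀ ≤ hcpE a h) →
      ∀ δ : ℝ, 0 < δ → ∃ κ : ℝ, 0 < κ ∧
        ∀ Dm : Measure (EuclideanSpace ℝ (Fin 3)) → ℝ≥0∞, Measurable Dm →
          (∀ μ : Measure (EuclideanSpace ℝ (Fin 3)), IsRootedHardCore δ μ →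
            Dm μ = ENNReal.ofReal
              (min (starDefect a₀ h₀ μ)
                  (⨅ A : EuclideanSpace ℝ (Fin 3) ≃ₗᵢ[ℝ] EuclideanSpace ℝ (Fin 3),
                    ∑ p ∈ fccKissingPattern, Metric.infDist (A (a₀ • p)) (rootStar μ) ^ 2) +
                (μ {y : EuclideanSpace ℝ (Fin 3) | 11 / 10 < ‖y‖ ∧ ‖y‖ ≤ 5 / 4}).toReal)) →
          ∀ P : Measure (Measure (EuclideanSpace ℝ (Fin 3))), IsProbabilityMeasure P →
            (∀ᵐ μ ∂P, IsRootedHardCore δ μ) → IsPointStationaryLaw P →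
            (∀ᵐ μ ∂P, ∃ S : Set (EuclideanSpace ℝ (Fin 3)),
              μ = (Measure.count : Measure (EuclideanSpace ℝ (Fin 3))).restrict S ∧
              (∀ y ∈ S, SetGood S y) ∧
              ∃ s : ℤ → ℤ, IsHaggSeq s ∧
                ∃ Φ : EuclideanSpace ℝ (Fin 3) → EuclideanSpace ℝ (Fin 3),
                  Set.BijOn Φ (barlowStacking 1 (Real.sqrt (2 / 3)) s) S ∧
                  ∀ p ∈ barlowStacking 1 (Real.sqrt (2 / 3)) s, ∀ q ∈ barlowStacking 1 (Real.sqrt (2 / 3)) s,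
                    (dist p q = 1 ↔ (0 < dist (Φ p) (Φ q) ∧ dist (Φ p) (Φ q) < 6 / 5))) →
            (∀ᵐ μ ∂P, ∃ S : Set (EuclideanSpace ℝ (Fin 3)),
              μ = (Measure.count : Measure (EuclideanSpace ℝ (Fin 3))).restrict S ∧
              ∀ p ∈ S, HasSum (fun q : {q : EuclideanSpace ℝ (Fin 3) // q ∈ S ∧ q ≠ p} =>
                (deriv lennardJones (dist p q.1) / dist p q.1) • (p - q.1)) 0) →
            (∀ M : EuclideanSpace ℝ (Fin 3) →L[ℝ] EuclideanSpace ℝ (Fin 3),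
              ∫ μ, (∫ y, deriv lennardJones ‖y‖ / ‖y‖ * inner ℝ y (M y) ∂μ) ∂P = 0) →
            hcpE a₀ h₀ + κ * (∫⁻ μ, Dm μ ∂P).toReal ≤ ∫ μ, (∫ y, lennardJones ‖y‖ ∂μ) / 2 ∂P)
    (hE1 : ∀ a₀ h₀ : ℝ, 189 / 200 ≤ a₀ → a₀ ≤ 199 / 200 → 77 / 100 ≤ h₀ → h₀ ≤ 163 / 200 →
      ∀ S : Set (EuclideanSpace ℝ (Fin 3)), (0 : EuclideanSpace ℝ (Fin 3)) ∈ S →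
        (∀ y ∈ S, SetGood S y) →
        (∃ s : ℤ → ℤ, IsHaggSeq s ∧
          ∃ Φ : EuclideanSpace ℝ (Fin 3) → EuclideanSpace ℝ (Fin 3),
            Set.BijOn Φ (barlowStacking 1 (Real.sqrt (2 / 3)) s) S ∧
            ∀ p ∈ barlowStacking 1 (Real.sqrt (2 / 3)) s, ∀ q ∈ barlowStacking 1 (Real.sqrt (2 / 3)) s,
              (dist p q = 1 ↔ (0 < dist (Φ p) (Φ q) ∧ dist (Φ p) (Φ q) < 6 / 5))) →
        (∀ x ∈ S,
          (starDefect a₀ h₀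
              ((Measure.count : Measure (EuclideanSpace ℝ (Fin 3))).restrict ((fun z : EuclideanSpace ℝ (Fin 3) => z - x) '' S)) = 0 ∨
            (⨅ A : EuclideanSpace ℝ (Fin 3) ≃ₗᵢ[ℝ] EuclideanSpace ℝ (Fin 3),
              ∑ p ∈ fccKissingPattern, Metric.infDist (A (a₀ • p))
                (rootStar ((Measure.count : Measure (EuclideanSpace ℝ (Fin 3))).restrict
                  ((fun z : EuclideanSpace ℝ (Fin 3) => z - x) '' S))) ^ 2) = 0) ∧
          (Measure.count : Measure (EuclideanSpace ℝ (Fin 3))).restrict ((fun z : EuclideanSpace ℝ (Fin 3) => z - x) '' S)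
            {y : EuclideanSpace ℝ (Fin 3) | 11 / 10 < ‖y‖ ∧ ‖y‖ ≤ 5 / 4} = 0) →
        ∃ A : EuclideanSpace ℝ (Fin 3) ≃ₗᵢ[ℝ] EuclideanSpace ℝ (Fin 3), ∃ h : ℝ, (h = h₀ ∨ h = a₀ * Real.sqrt (2 / 3)) ∧
          ∃ s' : ℤ → ℤ, IsHaggSeq s' ∧ S = A '' barlowStacking a₀ h s')
    (hE2 : ∀ a₀ h₀ : ℝ, 189 / 200 ≤ a₀ → a₀ ≤ 199 / 200 → 77 / 100 ≤ h₀ → h₀ ≤ 163 / 200 →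
      (∀ a h : ℝ, 0 < a → 0 < h → hcpE a₀ h₀ ≤ hcpE a h) →
      ∀ δ : ℝ, 0 < δ → ∀ P : Measure (Measure (EuclideanSpace ℝ (Fin 3))), IsProbabilityMeasure P →
        (∀ᵐ μ ∂P, IsRootedHardCore δ μ) → IsPointStationaryLaw P →
        (∫ μ, (∫ y, lennardJones ‖y‖ ∂μ) / 2 ∂P) ≤ hcpE a₀ h₀ →
        (∀ᵐ μ ∂P, ∃ A : EuclideanSpace ℝ (Fin 3) ≃ₗᵢ[ℝ] EuclideanSpace ℝ (Fin 3), ∃ h : ℝ,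
          (h = h₀ ∨ h = a₀ * Real.sqrt (2 / 3)) ∧ ∃ s : ℤ → ℤ, IsHaggSeq s ∧
            μ = (Measure.count : Measure (EuclideanSpace ℝ (Fin 3))).restrict (A '' barlowStacking a₀ h s)) →
        ∀ᵐ μ ∂P, ∃ A : EuclideanSpace ℝ (Fin 3) ≃ₗᵢ[ℝ] EuclideanSpace ℝ (Fin 3),
          μ = (Measure.count : Measure (EuclideanSpace ℝ (Fin 3))).restrict (A '' hcpStacking a₀ h₀)) :
    ∀ δ : ℝ, 0 < δ → ∀ P : Measure (Measure (EuclideanSpace ℝ (Fin 3))), IsProbabilityMeasure P →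
      (∀ᵐ μ ∂P, IsRootedHardCore δ μ) → IsPointStationaryLaw P →
      (∫ μ, (∫ y, lennardJones ‖y‖ ∂μ) / 2 ∂P) ≤
        (⨅ Q : PeriodicConfiguration 3, Q.energyPerParticle lennardJones) →
      (∀ᵐ μ ∂P, ∃ S : Set (EuclideanSpace ℝ (Fin 3)),
        μ = (Measure.count : Measure (EuclideanSpace ℝ (Fin 3))).restrict S ∧ ∀ y ∈ S, SetGood S y) →
      ∀ᵐ μ ∂P, ∃ a h : ℝ, ∃ ha : a ≠ 0, ∃ hh : h ≠ 0, 1 / 2 ≤ a ∧ a ≤ 2 ∧ 1 / 2 ≤ h ∧ h ≤ 2 ∧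
        ∃ A : EuclideanSpace ℝ (Fin 3) ≃ₗᵢ[ℝ] EuclideanSpace ℝ (Fin 3),
          (hcpPeriodicConfiguration ha hh).energyPerParticle lennardJones =
            (⨅ Q : PeriodicConfiguration 3, Q.energyPerParticle lennardJones) ∧
          μ = (Measure.count : Measure (EuclideanSpace ℝ (Fin 3))).restrict (A '' hcpStacking a h) := by
  intro δ hδ P hP hcore hstat hE hgood
  -- R1 (landed): chart the funnel
  have hchart : ∀ᵐ μ ∂P, ∃ S : Set (EuclideanSpace ℝ (Fin 3)),
      μ = (Measure.count : Measure (EuclideanSpace ℝ (Fin 3))).restrict S ∧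
      (∀ y ∈ S, SetGood S y) ∧
      ∃ s : ℤ → ℤ, IsHaggSeq s ∧
        ∃ Φ : EuclideanSpace ℝ (Fin 3) → EuclideanSpace ℝ (Fin 3),
          Set.BijOn Φ (barlowStacking 1 (Real.sqrt (2 / 3)) s) S ∧
          ∀ p ∈ barlowStacking 1 (Real.sqrt (2 / 3)) s, ∀ q ∈ barlowStacking 1 (Real.sqrt (2 / 3)) s,
            (dist p q = 1 ↔ (0 < dist (Φ p) (Φ q) ∧ dist (Φ p) (Φ q) < 6 / 5)) := by
    filter_upwards [hcore, hgood] with μ hc hg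
    obtain ⟨S, rfl, hS⟩ := hg
    obtain ⟨S₀, h0, -, hμ⟩ := hc
    have h0S : (0 : EuclideanSpace ℝ (Fin 3)) ∈ S := by
      have h1 : (Measure.count : Measure (EuclideanSpace ℝ (Fin 3))).restrict S {0} ≠ 0 := by
        rw [hμ]
        exact (count_restrict_singleton_ne_zero_iff S₀ 0).2 h0
      exact (count_restrict_singleton_ne_zero_iff S 0).1 h1
    obtain ⟨s, hs, Φ, hΦ, hbond⟩ :=
      Summit.AtomisticToContinuum.Crystallization.Theorems.PalmGoodLaw.FunnelChart.stub_funnelChart S ⟨0, h0S⟩ hS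
    exact ⟨S, rfl, hS, s, hs, Φ, hΦ, hbond⟩
  -- the relaxed reference and the level `E_P[h] ≤ e* ≤ hcpE a₀ h₀`
  obtain ⟨a₀, h₀, ha₁, ha₂, hh₁, hh₂, hmin⟩ := stub_relaxedReference
  have ha0 : 0 < a₀ := by linarith
  have hh0 : 0 < h₀ := by linarith
  have hstar : (⨅ Q : PeriodicConfiguration 3, Q.energyPerParticle lennardJones) ≤ hcpE a₀ h₀ :=
    Summit.AtomisticToContinuum.Crystallization.Theorems.PalmGoodLaw.RouteBetaFloor.iInf_le_hcpE ha0.ne' hh0.ne'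
  have hlevel : (∫ μ, (∫ y, lennardJones ‖y‖ ∂μ) / 2 ∂P) ≤ hcpE a₀ h₀ := hE.trans hstar
  -- the `e*`-level structure of minimising laws (landed)
  have hFB := Summit.AtomisticToContinuum.Crystallization.Theorems.PalmGoodLaw.RouteBetaFloor.ae_forceBalance_of_minimising
    hδ hcore hstat hE
  have hZS := Summit.AtomisticToContinuum.Crystallization.Theorems.PalmGoodLaw.RouteBetaFloor.zeroMeanStress_of_minimising
    hδ hcore hstat hE
  -- X1: the level is attained and the ROOT star is a.s. exact
  obtain ⟨hlow, hexact⟩ := ae_exactRoot_of_core hCORE ha₁ ha₂ hh₁ hh₂ hmin hδ hcore hstat hchart hFB hZS hlevel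
  have heq : hcpE a₀ h₀ = ⨅ Q : PeriodicConfiguration 3, Q.energyPerParticle lennardJones :=
    le_antisymm (hlow.trans hE) hstar
  -- every point a.s. (Aldous–Lyons; hard-core configurations are locally finite)
  have hlf : ∀ᵐ μ ∂P, ∀ n : ℕ,
      μ ((fun z : EuclideanSpace ℝ (Fin 3) => ⌊‖z‖⌋₊) ⁻¹' {n}) < ∞ := by
    filter_upwards [hcore] with μ hμ n
    obtain ⟨S, -, hsep, rfl⟩ := hμ
    exact count_restrict_floorNorm_preimage_lt_top hδ hsep n
  have hall := ae_forall_map_sub_of_ae hstat hlf hexact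
  -- X2: a.s. an exact stacking
  have hstack : ∀ᵐ μ ∂P, ∃ A : EuclideanSpace ℝ (Fin 3) ≃ₗᵢ[ℝ] EuclideanSpace ℝ (Fin 3), ∃ h : ℝ,
      (h = h₀ ∨ h = a₀ * Real.sqrt (2 / 3)) ∧ ∃ s : ℤ → ℤ, IsHaggSeq s ∧
        μ = (Measure.count : Measure (EuclideanSpace ℝ (Fin 3))).restrict (A '' barlowStacking a₀ h s) := by
    filter_upwards [hcore, hchart, hall] with μ hc hch ha
    obtain ⟨S, hμS, hgoodS, hch'⟩ := hch
    obtain ⟨S₀, h0, -, hμ0⟩ := hc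
    have h0S : (0 : EuclideanSpace ℝ (Fin 3)) ∈ S := by
      have h1 : (Measure.count : Measure (EuclideanSpace ℝ (Fin 3))).restrict S {0} ≠ 0 := by
        rw [← hμS, hμ0]
        exact (count_restrict_singleton_ne_zero_iff S₀ 0).2 h0
      exact (count_restrict_singleton_ne_zero_iff S 0).1 h1
    have hx : ∀ x ∈ S,
        (starDefect a₀ h₀
            ((Measure.count : Measure (EuclideanSpace ℝ (Fin 3))).restrict
              ((fun z : EuclideanSpace ℝ (Fin 3) => z - x) '' S)) = 0 ∨
          (⨅ A : EuclideanSpace ℝ (Fin 3) ≃ₗᵢ[ℝ] EuclideanSpace ℝ (Fin 3),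
            ∑ p ∈ fccKissingPattern, Metric.infDist (A (a₀ • p))
              (rootStar ((Measure.count : Measure (EuclideanSpace ℝ (Fin 3))).restrict
                ((fun z : EuclideanSpace ℝ (Fin 3) => z - x) '' S))) ^ 2) = 0) ∧
        (Measure.count : Measure (EuclideanSpace ℝ (Fin 3))).restrict ((fun z : EuclideanSpace ℝ (Fin 3) => z - x) '' S)
          {y : EuclideanSpace ℝ (Fin 3) | 11 / 10 < ‖y‖ ∧ ‖y‖ ≤ 5 / 4} = 0 := by
      intro x hxS
      have h1 := ha x (by rw [hμS]; exact (count_restrict_singleton_ne_zero_iff S x).2 hxS)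
      rwa [hμS, map_sub_count_restrict] at h1
    obtain ⟨A, h, hh, s', hs', hS⟩ := hE1 a₀ h₀ ha₁ ha₂ hh₁ hh₂ S h0S hgoodS hch' hx
    exact ⟨A, h, hh, s', hs', by rw [hμS, hS]⟩
  -- X3: a.s. exact relaxed hcp
  have hhcp := hE2 a₀ h₀ ha₁ ha₂ hh₁ hh₂ hmin δ hδ P hP hcore hstat hlevel hstack
  filter_upwards [hhcp] with μ hμ
  obtain ⟨A, hA⟩ := hμ
  refine ⟨a₀, h₀, ha0.ne', hh0.ne', by linarith, by linarith, by linarith, by linarith, A, ?_, hA⟩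
  rw [← heq]
  exact ((Summit.AtomisticToContinuum.Crystallization.Theorems.ExcessDecayLiouvilleCoarseGrains.hcpEnergySeries_of_eq
    a₀ h₀ ha0.ne' hh0.ne' hcpQ rfl).2.2)

/-! ## The kernel-checked composition: the three stub STATEMENTS prove the crux

`crux_unfolded_of_stubs : X1 → X2 → X3 → <the crux, unfolded by the definitional `PredicateAPI.defectFreeCrystallizes_iff`>` carries the
three stub statements as hypotheses (so its conclusion is deliberately NOT the crux constant: the A12 skeleton audit admits named
obligations only as hypotheses of a by-name theorem), and `DefectFreeCrystallizes_of : ReggeStarCoercivity.DefectFreeCrystallizes` is the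
ONE theorem of the file concluding the crux BY NAME, from the three `stub_*` (same layout as 9226's `LayeredLawsSelectHcp_of`). -/

/-- **Pure logic of the line** (no sorry, no stub used): X1 → X2 → X3 → the crux (unfolded: `(every LJ ground-state sequence has defect
fraction → 0) → IsCrystallizing lennardJones 3`), through the LANDED P1 `PalmGoodLaw.stub_goodLaw`, R3
`ChargeFromFunnelLaw.stub_chargeFromFunnelLaw`, item 2916 `chargedPatternCrystallizes_proof` and `LennardJonesMinimalDistance_holds`. -/
theorem crux_unfolded_of_stubs
    (hCORE : ∀ a₀ h₀ : ℝ, 189 / 200 ≤ a₀ → a₀ ≤ 199 / 200 → 77 / 100 ≤ h₀ → h₀ ≤ 163 / 200 →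
      (∀ a h : ℝ, 0 < a → 0 < h → hcpE a₀ h₀ ≤ hcpE a h) →
      ∀ δ : ℝ, 0 < δ → ∃ κ : ℝ, 0 < κ ∧
        ∀ Dm : Measure (EuclideanSpace ℝ (Fin 3)) → ℝ≥0∞, Measurable Dm →
          (∀ μ : Measure (EuclideanSpace ℝ (Fin 3)), IsRootedHardCore δ μ →
            Dm μ = ENNReal.ofReal
              (min (starDefect a₀ h₀ μ)
                  (⨅ A : EuclideanSpace ℝ (Fin 3) ≃ₗᵢ[ℝ] EuclideanSpace ℝ (Fin 3),
                    ∑ p ∈ fccKissingPattern, Metric.infDist (A (a₀ • p)) (rootStar μ) ^ 2) +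
                (μ {y : EuclideanSpace ℝ (Fin 3) | 11 / 10 < ‖y‖ ∧ ‖y‖ ≤ 5 / 4}).toReal)) →
          ∀ P : Measure (Measure (EuclideanSpace ℝ (Fin 3))), IsProbabilityMeasure P →
            (∀ᵐ μ ∂P, IsRootedHardCore δ μ) → IsPointStationaryLaw P →
            (∀ᵐ μ ∂P, ∃ S : Set (EuclideanSpace ℝ (Fin 3)),
              μ = (Measure.count : Measure (EuclideanSpace ℝ (Fin 3))).restrict S ∧
              (∀ y ∈ S, SetGood S y) ∧
              ∃ s : ℤ → ℤ, IsHaggSeq s ∧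
                ∃ Φ : EuclideanSpace ℝ (Fin 3) → EuclideanSpace ℝ (Fin 3),
                  Set.BijOn Φ (barlowStacking 1 (Real.sqrt (2 / 3)) s) S ∧
                  ∀ p ∈ barlowStacking 1 (Real.sqrt (2 / 3)) s, ∀ q ∈ barlowStacking 1 (Real.sqrt (2 / 3)) s,
                    (dist p q = 1 ↔ (0 < dist (Φ p) (Φ q) ∧ dist (Φ p) (Φ q) < 6 / 5))) →
            (∀ᵐ μ ∂P, ∃ S : Set (EuclideanSpace ℝ (Fin 3)),
              μ = (Measure.count : Measure (EuclideanSpace ℝ (Fin 3))).restrict S ∧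
              ∀ p ∈ S, HasSum (fun q : {q : EuclideanSpace ℝ (Fin 3) // q ∈ S ∧ q ≠ p} =>
                (deriv lennardJones (dist p q.1) / dist p q.1) • (p - q.1)) 0) →
            (∀ M : EuclideanSpace ℝ (Fin 3) →L[ℝ] EuclideanSpace ℝ (Fin 3),
              ∫ μ, (∫ y, deriv lennardJones ‖y‖ / ‖y‖ * inner ℝ y (M y) ∂μ) ∂P = 0) →
            hcpE a₀ h₀ + κ * (∫⁻ μ, Dm μ ∂P).toReal ≤ ∫ μ, (∫ y, lennardJones ‖y‖ ∂μ) / 2 ∂P)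
    (hE1 : ∀ a₀ h₀ : ℝ, 189 / 200 ≤ a₀ → a₀ ≤ 199 / 200 → 77 / 100 ≤ h₀ → h₀ ≤ 163 / 200 →
      ∀ S : Set (EuclideanSpace ℝ (Fin 3)), (0 : EuclideanSpace ℝ (Fin 3)) ∈ S →
        (∀ y ∈ S, SetGood S y) →
        (∃ s : ℤ → ℤ, IsHaggSeq s ∧
          ∃ Φ : EuclideanSpace ℝ (Fin 3) → EuclideanSpace ℝ (Fin 3),
            Set.BijOn Φ (barlowStacking 1 (Real.sqrt (2 / 3)) s) S ∧
            ∀ p ∈ barlowStacking 1 (Real.sqrt (2 / 3)) s, ∀ q ∈ barlowStacking 1 (Real.sqrt (2 / 3)) s,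
              (dist p q = 1 ↔ (0 < dist (Φ p) (Φ q) ∧ dist (Φ p) (Φ q) < 6 / 5))) →
        (∀ x ∈ S,
          (starDefect a₀ h₀
              ((Measure.count : Measure (EuclideanSpace ℝ (Fin 3))).restrict ((fun z : EuclideanSpace ℝ (Fin 3) => z - x) '' S)) = 0 ∨
            (⨅ A : EuclideanSpace ℝ (Fin 3) ≃ₗᵢ[ℝ] EuclideanSpace ℝ (Fin 3),
              ∑ p ∈ fccKissingPattern, Metric.infDist (A (a₀ • p))
                (rootStar ((Measure.count : Measure (EuclideanSpace ℝ (Fin 3))).restrict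
                  ((fun z : EuclideanSpace ℝ (Fin 3) => z - x) '' S))) ^ 2) = 0) ∧
          (Measure.count : Measure (EuclideanSpace ℝ (Fin 3))).restrict ((fun z : EuclideanSpace ℝ (Fin 3) => z - x) '' S)
            {y : EuclideanSpace ℝ (Fin 3) | 11 / 10 < ‖y‖ ∧ ‖y‖ ≤ 5 / 4} = 0) →
        ∃ A : EuclideanSpace ℝ (Fin 3) ≃ₗᵢ[ℝ] EuclideanSpace ℝ (Fin 3), ∃ h : ℝ, (h = h₀ ∨ h = a₀ * Real.sqrt (2 / 3)) ∧
          ∃ s' : ℤ → ℤ, IsHaggSeq s' ∧ S = A '' barlowStacking a₀ h s')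
    (hE2 : ∀ a₀ h₀ : ℝ, 189 / 200 ≤ a₀ → a₀ ≤ 199 / 200 → 77 / 100 ≤ h₀ → h₀ ≤ 163 / 200 →
      (∀ a h : ℝ, 0 < a → 0 < h → hcpE a₀ h₀ ≤ hcpE a h) →
      ∀ δ : ℝ, 0 < δ → ∀ P : Measure (Measure (EuclideanSpace ℝ (Fin 3))), IsProbabilityMeasure P →
        (∀ᵐ μ ∂P, IsRootedHardCore δ μ) → IsPointStationaryLaw P →
        (∫ μ, (∫ y, lennardJones ‖y‖ ∂μ) / 2 ∂P) ≤ hcpE a₀ h₀ →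
        (∀ᵐ μ ∂P, ∃ A : EuclideanSpace ℝ (Fin 3) ≃ₗᵢ[ℝ] EuclideanSpace ℝ (Fin 3), ∃ h : ℝ,
          (h = h₀ ∨ h = a₀ * Real.sqrt (2 / 3)) ∧ ∃ s : ℤ → ℤ, IsHaggSeq s ∧
            μ = (Measure.count : Measure (EuclideanSpace ℝ (Fin 3))).restrict (A '' barlowStacking a₀ h s)) →
        ∀ᵐ μ ∂P, ∃ A : EuclideanSpace ℝ (Fin 3) ≃ₗᵢ[ℝ] EuclideanSpace ℝ (Fin 3),
          μ = (Measure.count : Measure (EuclideanSpace ℝ (Fin 3))).restrict (A '' hcpStacking a₀ h₀)) :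
    (∀ x : (N : ℕ) → (Fin N → EuclideanSpace ℝ (Fin 3)), (∀ N, IsGroundState lennardJones (x N)) →
      Tendsto (fun N : ℕ => (defects (x N) : ℝ) / N) atTop (𝓝 0)) →
    IsCrystallizing lennardJones 3 := by
  intro hZ
  exact Summit.AtomisticToContinuum.Crystallization.Theorems.chargedPatternCrystallizes_proof
    (Summit.AtomisticToContinuum.Crystallization.Theorems.PalmGoodLaw.ChargeFromFunnelLaw.stub_chargeFromFunnelLaw
      Summit.AtomisticToContinuum.Crystallization.Theorems.PalmGoodLaw.stub_goodLaw
      (funnelLawRigidity_of_stubs hCORE hE1 hE2) hZ)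
    LennardJonesMinimalDistance_holds

/-- **The line concludes the crux BY NAME** (the only theorem of the file with this conclusion; sorries only inside the three
registered `stub_*`): `DefectFreeCrystallizes` from X1 `stub_funnelDefectFloor`, X2 `stub_exactStarRigidity`, X3 `stub_exactSelectionLaw`. -/
theorem DefectFreeCrystallizes_of :
    Summit.AtomisticToContinuum.Crystallization.Theses.ReggeStarCoercivity.DefectFreeCrystallizes :=
  defectFreeCrystallizes_iff.2
    (crux_unfolded_of_stubs stub_funnelDefectFloor stub_exactStarRigidity stub_exactSelectionLaw)

end Summit.AtomisticToContinuum.Crystallization.Cruxes.DefectFreeCrystallizes.ExactStarShortcut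

end
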